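import Literature.NumberTheory.LFunctions.PerronTruncatedBounded
import Literature.NumberTheory.LFunctions.NymanBeurlingProofs
import HarnessLib

/-!
# Perron's formula for the twisted Möbius sums `M_N(iτ) = Σ_{n≤N} μ(n) n^{-iτ}` (Balazard–de Roton 2010, (t45))

Topic `Literature/NumberTheory/LFunctions`; first step ("Première étape : formule de Perron") of
the proof of Proposition 12 of M. Balazard, A. de Roton, *Sur un critère de Báez-Duarte pour
l'hypothèse de Riemann*, Int. J. Number Theory 6 (2010) 883–903 (arXiv:0812.1689, §6.2, p. 8), a
brick of the proof of `Literature.NumberTheory.LFunctions.BalazardDeRoton2010_thm1`: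

> `M_N(iτ) = (1/2πi)∫_{1+1/log N − iN₁}^{1+1/log N + iN₁} ζ(z+iτ)^{-1} N^z dz/z + O(N log N₁/N₁)`
> `= …`; "Pour `N ≥ 3` et `|τ| ≤ N/5` on a donc montré
> `M_N(iτ) = N^{-iτ} B_N + O((1+|τ|) log N)` (t45), where
> `B_N = B_N(iτ) = (1/2πi)∫_{1+1/log N−iN₁}^{1+1/log N+iN₁} ζ(z)^{-1} N^z dz/(z−iτ)`."

We prove it at the half-integer `x = N + 1/2` (so that `Σ_{n<x} = Σ_{n≤N}` and the truncated Perron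
formula of `PerronTruncatedBounded.lean` applies verbatim), `c = 1 + 1/log x`, for every truncation
height `x/2 ≤ T ≤ x` and `|τ| ≤ T/4`:

`‖M_N(iτ) − (1/2π) x^{-iτ} ∫_{-T}^{T} ζ(c+iu)^{-1} x^{c+iu}/(c+iu−iτ) du‖ ≤ K (1 + |τ|) log x`

(`MoebiusTwistPerron.norm_moebiusSum_twist_sub_perron_le`; `M_N(iτ)` is the tree's
`BaezDuarteOnlyIf.moebiusSum N (τ I)`). Steps, as printed: the Dirichlet series of
`a(n) = μ(n) n^{-iτ}` is `ζ(s+iτ)^{-1}` (`LSeries_moebius_twist`); Perron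
(`PerronBounded.exists_norm_perron_bounded_sub_le`); the change of variable `u = t + τ`; and trimming
`[−T+τ, T+τ]` back to `[−T, T]` at the cost `O(|τ| log x)` (`|ζ(z)^{-1}| ≤ c/(c−1) ≤ 2 log x` on
`Re z = c`, `|z − iτ| ≥ T/2` on the trimmed ends).

## References

* [BalazardDeRoton2010] M. Balazard, A. de Roton, Int. J. Number Theory 6 (2010), §6.2, "Première
  étape", eq. (t45) (arXiv:0812.1689 p. 8).
* [BalazardRoton2008] M. Balazard, A. de Roton, arXiv:0810.3587, Prop. 21 (the Perron formula
  used).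
-/

noncomputable section

open Complex Set MeasureTheory Filter Topology intervalIntegral Real

namespace Literature.NumberTheory.LFunctions

namespace MoebiusTwistPerron

open BaezDuarteOnlyIf (moebiusSum)

/-! ### The twisted Möbius coefficients `a(n) = μ(n) n^{-iτ}` -/

/-- `a(n) = μ(n)/n^{iτ}`. [cite: BalazardDeRoton2010, §6.2] -/
def twistCoeff (τ : ℝ) (n : ℕ) : ℂ := (ArithmeticFunction.moebius n : ℂ) / (n : ℂ) ^ ((τ : ℂ) * I)

/-- `‖n^{iτ}‖ = 1` for `n ≥ 1`. [folklore] -/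
lemma norm_natCast_cpow_mul_I {n : ℕ} (hn : n ≠ 0) (τ : ℝ) : ‖(n : ℂ) ^ ((τ : ℂ) * I)‖ = 1 := by
  rw [Complex.norm_natCast_cpow_of_pos (Nat.pos_of_ne_zero hn)]
  simp

/-- `‖a(n)‖ ≤ 1`. [folklore] -/
lemma norm_twistCoeff_le (τ : ℝ) (n : ℕ) : ‖twistCoeff τ n‖ ≤ 1 := by
  unfold twistCoeff
  rcases eq_or_ne n 0 with rfl | hn
  · simp
  rw [norm_div, norm_natCast_cpow_mul_I hn, div_one, Complex.norm_intCast]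
  exact_mod_cast ArithmeticFunction.abs_moebius_le_one

/-- `Σ_{1≤n≤N} a(n) = M_N(iτ)`. [cite: BalazardDeRoton2010, §6.2] -/
lemma sum_twistCoeff (τ : ℝ) (N : ℕ) :
    ∑ n ∈ Finset.Icc 1 N, twistCoeff τ n = moebiusSum N ((τ : ℂ) * I) := by
  rfl

/-- On `Re s > 1`, `1/ζ(s) = Σ μ(n) n^{-s}` (Mathlib's `L(1,s)L(μ,s) = 1`). [folklore] -/
lemma inv_riemannZeta_eq_LSeries {s : ℂ} (hs : 1 < s.re) :
    (riemannZeta s)⁻¹ = LSeries (fun n ↦ (ArithmeticFunction.moebius n : ℂ)) s := by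
  have hprod := LSeries_one_mul_Lseries_moebius hs
  rw [LSeries_one_eq_riemannZeta hs] at hprod
  have hζ : riemannZeta s ≠ 0 := riemannZeta_ne_zero_of_one_lt_re hs
  rw [eq_comm, ← mul_right_inj' hζ, hprod, mul_inv_cancel₀ hζ]

/-- **`L(a, s) = ζ(s+iτ)^{-1}`** for `Re s > 1`. [cite: BalazardDeRoton2010, §6.2] -/
theorem LSeries_twistCoeff {τ : ℝ} {s : ℂ} (hs : 1 < s.re) :
    LSeries (twistCoeff τ) s = (riemannZeta (s + τ * I))⁻¹ := by
  have hs' : 1 < (s + τ * I).re := by simpa using hs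
  rw [inv_riemannZeta_eq_LSeries hs', LSeries, LSeries]
  refine tsum_congr fun n ↦ ?_
  rcases eq_or_ne n 0 with rfl | hn
  · simp
  rw [LSeries.term_of_ne_zero hn, LSeries.term_of_ne_zero hn, twistCoeff,
    Complex.cpow_add _ _ (Nat.cast_ne_zero.2 hn)]
  field_simp

/-! ### The integrand on the line `Re z = c` and its bounds -/

/-- On `Re z = c ∈ (1, 2]`: `‖ζ(z)^{-1}‖ ≤ c/(c−1)` (`1/ζ = L(μ, ·)`, `|μ| ≤ 1`). [folklore] -/
lemma norm_inv_zeta_le {c : ℝ} (hc1 : 1 < c) (u : ℝ) :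
    ‖(riemannZeta (c + u * I))⁻¹‖ ≤ c / (c - 1) := by
  have hs : 1 < ((c : ℂ) + u * I).re := by simp [hc1]
  rw [inv_riemannZeta_eq_LSeries hs]
  have h := ZetaClassicalRegion.norm_LSeries_le_of_norm_le_one
    (f := fun n ↦ (ArithmeticFunction.moebius n : ℂ)) (fun n ↦ ?_) hs
  · simpa using h
  · rw [Complex.norm_intCast]; exact_mod_cast ArithmeticFunction.abs_moebius_le_one

/-- Continuity of `u ↦ ζ(c+iu)^{-1}` for `c > 1`. [folklore] -/
lemma continuous_inv_zeta_line {c : ℝ} (hc1 : 1 < c) :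
    Continuous fun u : ℝ ↦ (riemannZeta (c + u * I))⁻¹ := by
  have hline : Continuous fun u : ℝ ↦ (c : ℂ) + u * I := by fun_prop
  refine Continuous.inv₀ ?_ fun u ↦ riemannZeta_ne_zero_of_one_lt_re (by simp [hc1])
  refine continuous_iff_continuousAt.2 fun u ↦ ?_
  have hne : (c : ℂ) + u * I ≠ 1 := fun h ↦ by
    have := congrArg Complex.re h; simp at this; linarith
  exact ContinuousAt.comp (f := fun u : ℝ ↦ (c : ℂ) + u * I)
    (differentiableAt_riemannZeta hne).continuousAt hline.continuousAt

/-- Continuity of the twisted Perron integrand `u ↦ ζ(c+iu)^{-1} x^{c+iu}/(c+iu−iτ)`. [folklore] -/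
lemma continuous_integrand {x c : ℝ} (hx : 0 < x) (hc1 : 1 < c) (τ : ℝ) :
    Continuous fun u : ℝ ↦ (riemannZeta (c + u * I))⁻¹ *
      ((x : ℂ) ^ ((c : ℂ) + u * I) / ((c : ℂ) + u * I - τ * I)) := by
  have hne : ∀ u : ℝ, (c : ℂ) + u * I - τ * I ≠ 0 := fun u h ↦ by
    have := congrArg Complex.re h; simp at this; linarith
  refine (continuous_inv_zeta_line hc1).mul ?_
  refine Continuous.div ?_ (by fun_prop) hne
  exact (continuous_const.cpow (by fun_prop) fun u ↦ Or.inl (by simpa using hx))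

/-- The pointwise bound on the trimmed ends: for `|u − τ| ≥ T/2`,
`‖ζ(c+iu)^{-1} x^{c+iu}/(c+iu−iτ)‖ ≤ (c/(c−1)) x^c (2/T)`. [folklore] -/
lemma norm_integrand_le {x c T : ℝ} (hx : 0 < x) (hc1 : 1 < c) (hT : 0 < T) {τ u : ℝ}
    (hu : T / 2 ≤ |u - τ|) :
    ‖(riemannZeta (c + u * I))⁻¹ * ((x : ℂ) ^ ((c : ℂ) + u * I) / ((c : ℂ) + u * I - τ * I))‖ ≤
      c / (c - 1) * x ^ c * (2 / T) := by
  rw [norm_mul, norm_div]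
  have h1 := norm_inv_zeta_le hc1 u
  have h2 : ‖(x : ℂ) ^ ((c : ℂ) + u * I)‖ = x ^ c := by
    rw [Complex.norm_cpow_eq_rpow_re_of_pos hx]; simp
  have h3 : T / 2 ≤ ‖(c : ℂ) + u * I - τ * I‖ := by
    have := Complex.abs_im_le_norm ((c : ℂ) + u * I - τ * I)
    simp at this
    exact hu.trans this
  have hT2 : 0 < T / 2 := by positivity
  rw [h2]
  calc ‖(riemannZeta (c + u * I))⁻¹‖ * (x ^ c / ‖(c : ℂ) + u * I - τ * I‖)
      ≤ c / (c - 1) * (x ^ c / (T / 2)) :=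
        mul_le_mul h1 (div_le_div_of_nonneg_left (by positivity) hT2 h3) (by positivity)
          (div_nonneg (by linarith) (by linarith))
    _ = c / (c - 1) * x ^ c * (2 / T) := by ring

/-! ### The formula -/

/-- **Balazard–de Roton 2010, (t45), at half-integers.** There is an absolute `K` such that for
`N ≥ 3`, `x = N + 1/2`, `c = 1 + 1/log x`, `x/2 ≤ T ≤ x` and `|τ| ≤ T/4`:
`‖M_N(iτ) − (2π)^{-1} x^{-iτ} ∫_{-T}^{T} ζ(c+iu)^{-1} x^{c+iu}/(c+iu−iτ) du‖ ≤ K (1 + |τ|) log x`.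
[cite: BalazardDeRoton2010, §6.2 eq. (t45)] -/
theorem norm_moebiusSum_twist_sub_perron_le :
    ∃ K : ℝ, 0 < K ∧ ∀ N : ℕ, 3 ≤ N → ∀ x c : ℝ, x = N + 1 / 2 → c = 1 + 1 / Real.log x →
      ∀ T : ℝ, x / 2 ≤ T → T ≤ x → ∀ τ : ℝ, |τ| ≤ T / 4 →
        ‖moebiusSum N ((τ : ℂ) * I) - (2 * π : ℂ)⁻¹ * (x : ℂ) ^ (-((τ : ℂ) * I)) *
            ∫ u in (-T)..T, (riemannZeta (c + u * I))⁻¹ *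
              ((x : ℂ) ^ ((c : ℂ) + u * I) / ((c : ℂ) + u * I - τ * I))‖ ≤
          K * (1 + |τ|) * Real.log x := by
  obtain ⟨K, hK0, hK⟩ := PerronBounded.exists_norm_perron_bounded_sub_le
  refine ⟨4 * K + 32 * Real.exp 1, by positivity, fun N hN x c hx hc T hTx hT τ hτ ↦ ?_⟩
  obtain ⟨hx0, hlog, hc1, hc2, hxc, _⟩ := halfInt_facts hN hx hc
  have hT0 : 0 < T := by linarith
  have hlog0 : 0 < Real.log x := by linarith
  have hc1' : 1 / (c - 1) = Real.log x := by rw [hc, add_sub_cancel_left, one_div_one_div]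
  -- the integrands
  set g : ℝ → ℂ := fun u ↦ (riemannZeta (c + u * I))⁻¹ *
    ((x : ℂ) ^ ((c : ℂ) + u * I) / ((c : ℂ) + u * I - τ * I)) with hg
  have hgc : Continuous g := continuous_integrand hx0 hc1 τ
  -- Step 1: Perron for `a = twistCoeff τ`
  have hP := hK (twistCoeff τ) (norm_twistCoeff_le τ) N hN x c hx hc T T hT0 hT0
  rw [sum_twistCoeff] at hP
  -- Step 2: identify the Perron integrand with `x^{-iτ} g(t + τ)`
  have hxne : (x : ℂ) ≠ 0 := Complex.ofReal_ne_zero.2 hx0.ne'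
  have hshift : ∀ t : ℝ, LSeries (twistCoeff τ) (c + t * I) *
      ((x : ℂ) ^ ((c : ℂ) + t * I) / ((c : ℂ) + t * I)) = (x : ℂ) ^ (-((τ : ℂ) * I)) * g (t + τ) := by
    intro t
    have hs : 1 < ((c : ℂ) + t * I).re := by simp [hc1]
    rw [LSeries_twistCoeff hs, hg]
    simp only
    have e1 : (c : ℂ) + t * I + τ * I = (c : ℂ) + ((t + τ : ℝ) : ℂ) * I := by push_cast; ring
    have e2 : (c : ℂ) + ((t + τ : ℝ) : ℂ) * I - τ * I = (c : ℂ) + t * I := by push_cast; ring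
    have e3 : (x : ℂ) ^ ((c : ℂ) + ((t + τ : ℝ) : ℂ) * I) =
        (x : ℂ) ^ ((c : ℂ) + t * I) * (x : ℂ) ^ ((τ : ℂ) * I) := by
      rw [← Complex.cpow_add _ _ hxne]; congr 1; push_cast; ring
    have e4 : (x : ℂ) ^ (-((τ : ℂ) * I)) * (x : ℂ) ^ ((τ : ℂ) * I) = 1 := by
      rw [← Complex.cpow_add _ _ hxne, neg_add_cancel, Complex.cpow_zero]
    rw [e1, e2, e3]
    calc (riemannZeta (c + ((t + τ : ℝ) : ℂ) * I))⁻¹ * ((x : ℂ) ^ ((c : ℂ) + t * I) / ((c : ℂ) + t * I))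
        = ((x : ℂ) ^ (-((τ : ℂ) * I)) * (x : ℂ) ^ ((τ : ℂ) * I)) *
            ((riemannZeta (c + ((t + τ : ℝ) : ℂ) * I))⁻¹ *
              ((x : ℂ) ^ ((c : ℂ) + t * I) / ((c : ℂ) + t * I))) := by rw [e4, one_mul]
      _ = (x : ℂ) ^ (-((τ : ℂ) * I)) * ((riemannZeta (c + ((t + τ : ℝ) : ℂ) * I))⁻¹ *
            ((x : ℂ) ^ ((c : ℂ) + t * I) * (x : ℂ) ^ ((τ : ℂ) * I) / ((c : ℂ) + t * I))) := by ring
  have hPint : (∫ t in (-T)..T, LSeries (twistCoeff τ) (c + t * I) *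
      ((x : ℂ) ^ ((c : ℂ) + t * I) / ((c : ℂ) + t * I))) =
      (x : ℂ) ^ (-((τ : ℂ) * I)) * ∫ u in (-T + τ)..(T + τ), g u := by
    rw [intervalIntegral.integral_congr (g := fun t ↦ (x : ℂ) ^ (-((τ : ℂ) * I)) * g (t + τ))
      (fun t _ ↦ hshift t), intervalIntegral.integral_const_mul,
      intervalIntegral.integral_comp_add_right (fun u ↦ g u) τ]
  -- Step 3: trim the shifted range back to `[-T, T]`
  have hgi : ∀ a b : ℝ, IntervalIntegrable g volume a b := fun a b ↦ hgc.intervalIntegrable a b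
  have hsplit : (∫ u in (-T + τ)..(T + τ), g u) =
      (∫ u in (-T)..T, g u) - (∫ u in (-T)..(-T + τ), g u) + ∫ u in T..(T + τ), g u := by
    have h1 := intervalIntegral.integral_add_adjacent_intervals (hgi (-T + τ) (-T)) (hgi (-T) (T + τ))
    have h2 := intervalIntegral.integral_add_adjacent_intervals (hgi (-T) T) (hgi T (T + τ))
    have h3 := intervalIntegral.integral_symm (μ := volume) (f := g) (-T) (-T + τ)
    rw [← h1, ← h2, h3]
    ring
  -- bounds on the two trimmed pieces
  have hxcT : c / (c - 1) * x ^ c * (2 / T) ≤ 16 * Real.exp 1 * Real.log x := by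
    rw [show c / (c - 1) = c * (1 / (c - 1)) by ring, hc1', hxc]
    have h1 : x * (2 / T) ≤ 4 := by
      rw [mul_div_assoc', div_le_iff₀ hT0]; linarith
    have h2 : c * Real.log x * (Real.exp 1 * x) * (2 / T) =
        (c * Real.exp 1 * Real.log x) * (x * (2 / T)) := by ring
    rw [h2]
    calc c * Real.exp 1 * Real.log x * (x * (2 / T)) ≤ (2 * Real.exp 1 * Real.log x) * 4 := by
          refine mul_le_mul ?_ h1 (by positivity) (by positivity)
          have h := mul_le_mul_of_nonneg_right hc2 (by positivity : (0 : ℝ) ≤ Real.exp 1 * Real.log x)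
          calc c * Real.exp 1 * Real.log x = c * (Real.exp 1 * Real.log x) := by ring
            _ ≤ 2 * (Real.exp 1 * Real.log x) := h
            _ = 2 * Real.exp 1 * Real.log x := by ring
      _ = 8 * Real.exp 1 * Real.log x := by ring
      _ ≤ 16 * Real.exp 1 * Real.log x := by nlinarith [Real.exp_pos 1, hlog0]
  have hend : ∀ a : ℝ, T ≤ |a| → (∀ u ∈ Set.uIcc a (a + τ), T / 2 ≤ |u - τ|) →
      ‖∫ u in a..(a + τ), g u‖ ≤ 16 * Real.exp 1 * Real.log x * |τ| := by
    intro a ha hfar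
    have h := intervalIntegral.norm_integral_le_of_norm_le_const (a := a) (b := a + τ) (f := g)
      (C := c / (c - 1) * x ^ c * (2 / T)) fun u hu ↦
        norm_integrand_le hx0 hc1 hT0 (hfar u (Set.uIoc_subset_uIcc hu))
    rw [show |a + τ - a| = |τ| by ring_nf] at h
    refine h.trans ?_
    exact mul_le_mul_of_nonneg_right hxcT (abs_nonneg τ)
  have hfar1 : ∀ u ∈ Set.uIcc T (T + τ), T / 2 ≤ |u - τ| := by
    intro u hu
    rcases Set.mem_uIcc.1 hu with h | h
    · have : T / 2 ≤ u - τ := by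
        have hτ' := (abs_le.1 hτ).2; linarith [h.1]
      exact this.trans (le_abs_self _)
    · have : T / 2 ≤ u - τ := by
        have hτ' := (abs_le.1 hτ).2; have hτ'' := (abs_le.1 hτ).1; linarith [h.1]
      exact this.trans (le_abs_self _)
  have hfar2 : ∀ u ∈ Set.uIcc (-T) (-T + τ), T / 2 ≤ |u - τ| := by
    intro u hu
    rcases Set.mem_uIcc.1 hu with h | h
    · have : u - τ ≤ -(T / 2) := by
        have hτ' := (abs_le.1 hτ).1; have hτ'' := (abs_le.1 hτ).2; linarith [h.2]
      rw [abs_sub_comm]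
      have : T / 2 ≤ τ - u := by linarith
      exact this.trans (le_abs_self _)
    · have : u - τ ≤ -(T / 2) := by
        have hτ' := (abs_le.1 hτ).1; have hτ'' := (abs_le.1 hτ).2; linarith [h.2]
      rw [abs_sub_comm]
      have : T / 2 ≤ τ - u := by linarith
      exact this.trans (le_abs_self _)
  have hE1 := hend T (by rw [abs_of_pos hT0]) hfar1
  have hE2 := hend (-T) (by rw [abs_neg, abs_of_pos hT0]) hfar2
  -- Step 4: assemble
  have h2π : (2 * π : ℂ) ≠ 0 := by
    have : (π : ℂ) ≠ 0 := Complex.ofReal_ne_zero.2 Real.pi_ne_zero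
    exact mul_ne_zero two_ne_zero this
  have hnormx : ‖(x : ℂ) ^ (-((τ : ℂ) * I))‖ = 1 := by
    rw [Complex.norm_cpow_eq_rpow_re_of_pos hx0]; simp
  -- `M − (2π)⁻¹ x^{-iτ} ∫_{-T}^{T} g = (2π)⁻¹ [ (2π M − Perron integral) + x^{-iτ}(∫_{T}^{T+τ} − ∫_{-T}^{-T+τ}) ]`
  have hkey : moebiusSum N ((τ : ℂ) * I) - (2 * π : ℂ)⁻¹ * (x : ℂ) ^ (-((τ : ℂ) * I)) *
        ∫ u in (-T)..T, g u =
      (2 * π : ℂ)⁻¹ * ((2 * π * moebiusSum N ((τ : ℂ) * I) -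
          ∫ t in (-T)..T, LSeries (twistCoeff τ) (c + t * I) *
            ((x : ℂ) ^ ((c : ℂ) + t * I) / ((c : ℂ) + t * I))) +
        (x : ℂ) ^ (-((τ : ℂ) * I)) * ((∫ u in T..(T + τ), g u) - ∫ u in (-T)..(-T + τ), g u)) := by
    rw [hPint, hsplit]
    field_simp
    ring
  rw [hkey, norm_mul, norm_inv]
  have hπ : ‖(2 * π : ℂ)‖ = 2 * π := by
    rw [norm_mul, Complex.norm_ofNat, Complex.norm_real, Real.norm_eq_abs, abs_of_pos Real.pi_pos]
  rw [hπ]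
  have hA : ‖2 * π * moebiusSum N ((τ : ℂ) * I) -
      ∫ t in (-T)..T, LSeries (twistCoeff τ) (c + t * I) *
        ((x : ℂ) ^ ((c : ℂ) + t * I) / ((c : ℂ) + t * I))‖ ≤ 4 * K * Real.log x := by
    rw [norm_sub_rev]
    refine hP.trans ?_
    have h1 : 1 / T + 1 / T ≤ 4 / x := by
      rw [show 1 / T + 1 / T = 2 / T by ring, div_le_div_iff₀ hT0 hx0]; linarith
    calc K * x * Real.log x * (1 / T + 1 / T) ≤ K * x * Real.log x * (4 / x) :=
          mul_le_mul_of_nonneg_left h1 (by positivity)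
      _ = 4 * K * Real.log x := by field_simp
  have hB : ‖(x : ℂ) ^ (-((τ : ℂ) * I)) * ((∫ u in T..(T + τ), g u) - ∫ u in (-T)..(-T + τ), g u)‖ ≤
      32 * Real.exp 1 * Real.log x * |τ| := by
    rw [norm_mul, hnormx, one_mul]
    refine (norm_sub_le _ _).trans ?_
    linarith
  have hπ3 : (3 : ℝ) < π := Real.pi_gt_three
  calc (2 * π)⁻¹ * ‖(2 * π * moebiusSum N ((τ : ℂ) * I) -
          ∫ t in (-T)..T, LSeries (twistCoeff τ) (c + t * I) *
            ((x : ℂ) ^ ((c : ℂ) + t * I) / ((c : ℂ) + t * I))) +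
        (x : ℂ) ^ (-((τ : ℂ) * I)) * ((∫ u in T..(T + τ), g u) - ∫ u in (-T)..(-T + τ), g u)‖
      ≤ (2 * π)⁻¹ * (4 * K * Real.log x + 32 * Real.exp 1 * Real.log x * |τ|) := by
        refine mul_le_mul_of_nonneg_left ((norm_add_le _ _).trans (add_le_add hA hB)) (by positivity)
    _ ≤ 1 * (4 * K * Real.log x + 32 * Real.exp 1 * Real.log x * |τ|) := by
        refine mul_le_mul_of_nonneg_right ?_ (by positivity)
        rw [inv_le_comm₀ (by positivity) one_pos, inv_one]; linarith
    _ ≤ (4 * K + 32 * Real.exp 1) * (1 + |τ|) * Real.log x := by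
        have h1 : 0 ≤ K * Real.log x * |τ| := by positivity
        have h2 : 0 ≤ Real.exp 1 * Real.log x := by positivity
        nlinarith [h1, h2, abs_nonneg τ]

end MoebiusTwistPerron

end Literature.NumberTheory.LFunctions

end
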